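import Literature.NumberTheory.Automorphic.Liu2021.AlbaneseCocycleOfPieces
import Literature.NumberTheory.Automorphic.Liu2021.AlbaneseBaseChangeProduct
import Literature.NumberTheory.Automorphic.Liu2021.NablaGaloisDescent
import Literature.NumberTheory.Automorphic.Liu2021.SplittingField
import HarnessLib

/-!
# Liu 2021 §2.1 Def. 2.1 (1): `∇X` is TRANSITIVE (an equivalence relation) for smooth projective `X` in characteristic zero

[Liu2021] = Yifeng Liu, *Fourier–Jacobi cycles and arithmetic relative trace formula*, Camb. J. Math. **9** (2021)
= arXiv:2102.11518 (v2 numbering; `l. NNNN` = lines of `FJcycle.tex`).  Def. 2.1 (1) (l. 1171–1174): `∇X` is «the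
smallest open and closed subscheme of `X × X` containing the diagonal»; proof of the Proposition (l. 1194–1200): over a
splitting field `k'`, «`∇_{k'}X' = ⊔ᵢ Xᵢ × Xᵢ`» and «`(∇X)_{k'} ≃ ∇_{k'}X'`».  Hence `∇X` is an EQUIVALENCE RELATION on `X`:
symmetry is formal from minimality (`Nabla.exists_swap`, `AppendixC/AlbaneseCocycle.lean`); TRANSITIVITY — typed in Yoneda
form as `Nabla.IsTransitive` (ibid.): `T`-points over `(a,b)` and `(b,c)` give one over `(a,c)` — is proved HERE (piece P3c
of the discharge of `AlbaneseTraceOfFiniteQuotient`, cell hodgecm-mathlib row VI-5; the «`∇` of a quotient» half of P2 is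
NOT touched):

* `Nabla.nonempty_of_isColimit` — a split scheme `X' ≅ ∐_c Y_c` (finite, geometrically irreducible pieces) HAS a `∇X'`,
  namely `⋃_c Y_c × Y_c` (constructor `Nabla.exists_of_isClopen` + `range_tensorHom_subset_range_of_diag`).
* `Nabla.isTransitive_of_isColimit` — every `∇X'` of such a split `X'` is transitive: if `(a,b), (b,c)` are `T`-points of
  `∇X'` then pointwise `a, b, c` lie in the same piece (`Nabla.snd_mem_range_of_fst_mem_range`,
  `Liu2021/AlbaneseCocycleOfPieces`), so `(a,c) : T → X' × X'` has image in `⋃_c Y_c × Y_c ⊆ ∇X'` and lifts through the open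
  immersion `∇X' ↪ X' × X'` (Mathlib `IsOpenImmersion.lift`).
* `Nabla.IsTransitive.of_baseChange` — transitivity descends along a field extension `L / k` through an isomorphism
  `(∇X)_L ≅ ∇(X_L)` over `X_L × X_L` (`Nabla.exists_of_nabla_baseChange_incl`): the projection `T_L → T` is surjective.
* `Nabla.isTransitive_of_isProjectiveOver` — **for `k` of characteristic zero (any universe) and `X` smooth of some
  relative dimension and projective over `k`, EVERY `∇X` is transitive** (finite Galois splitting field,
  `exists_isGalois_isColimit_isSmoothProjective`).

HC_CM is NOT proved here; nothing discharges a COR-CM binder.  Ours; axioms `propext`, `Classical.choice`, `Quot.sound`.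

## References
* [Liu2021] Y. Liu, arXiv:2102.11518 = Camb. J. Math. 9 (2021), §2.1 Def. 2.1 (1) (l. 1171–1176) and the proof of the
  Proposition (l. 1194–1200).
* [GortzWedhorn2020] U. Görtz, T. Wedhorn, *Algebraic Geometry I* (2nd ed. 2020), §(14.20), Def. 14.84.
-/

noncomputable section

open CategoryTheory CategoryTheory.Limits AlgebraicGeometry MonoidalCategory CartesianMonoidalCategory
open Literature.AlgebraicGeometry.Motives

namespace Literature.NumberTheory.Automorphic.Liu2021.AppendixC

open AbelianVariety (bcSpec bcFunctor)

set_option backward.isDefEq.respectTransparency false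

universe u v

/-! ## Split schemes -/

section Pieces

variable {L : Type u} [Field L] {X' : SchemeOver L} {κ : Type v} [Small.{u} κ] {Y : κ → SchemeOver L}
  {inj : ∀ c, Y c ⟶ X'}

omit [Small.{u} κ] in
/-- The image of `f × g` in `X' × Y'` is `pr₁⁻¹(im f) ∩ pr₂⁻¹(im g)` (Mathlib `Scheme.Pullback.range_map`). [folklore] -/
private theorem range_tensorHom_left_eq {X₁ Y₁ X₂ Y₂ : SchemeOver L} (f : X₁ ⟶ X₂) (g : Y₁ ⟶ Y₂) :
    Set.range (f ⊗ₘ g).left = (fst X₂ Y₂).left ⁻¹' Set.range f.left ∩ (snd X₂ Y₂).left ⁻¹' Set.range g.left := by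
  rw [Over.tensorHom_left]
  exact Scheme.Pullback.range_map _ _ _ _ _ _ _ _ _

/-- **A split scheme has a `∇`**: for a colimit cofan `inj_c : Y_c ⟶ X'` (`κ` finite) of geometrically irreducible
`L`-schemes, `⋃_c Y_c × Y_c ⊆ X' × X'` is open and closed, contains the diagonal and is contained in every open and closed
subscheme through which the diagonal factors (`range_tensorHom_subset_range_of_diag`), hence is a `∇X'` (Def. 2.1 (1);
«`∇_{k'}X' = ⊔ᵢ Xᵢ × Xᵢ`», l. 1194–1200).  Ours. [cite: Liu2021, §2.1 Def. 2.1 (1) (l. 1171–1174) and proof of the Proposition (l. 1194–1200)] -/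
theorem Nabla.nonempty_of_isColimit [Finite κ] (hcol : IsColimit (Cofan.mk X' inj))
    (hirr : ∀ c, GeometricallyIrreducible (Y c).hom) : Nonempty (Nabla X') := by
  haveI := hirr
  set R : κ → Set X'.left := fun c => Set.range (inj c).left with hR
  set U : Set ↥(X' ⊗ X').left := ⋃ c, ⇑(fst X' X').left ⁻¹' R c ∩ ⇑(snd X' X').left ⁻¹' R c with hU
  have hRc : ∀ c, IsClopen (R c) := fun c => isClopen_range_left_of_isColimit hcol c
  have hUo : IsOpen U := isOpen_iUnion fun c =>
    ((hRc c).2.preimage (fst X' X').left.continuous).inter ((hRc c).2.preimage (snd X' X').left.continuous)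
  have hUc : IsClosed U := isClosed_iUnion_of_finite fun c =>
    ((hRc c).1.preimage (fst X' X').left.continuous).inter ((hRc c).1.preimage (snd X' X').left.continuous)
  have hΔ : Set.range ⇑(lift (𝟙 X') (𝟙 X')).left ⊆ U := by
    rintro _ ⟨x, rfl⟩
    obtain ⟨c, y, hy⟩ := exists_eq_left_of_isColimit hcol x
    refine Set.mem_iUnion.mpr ⟨c, ?_, ?_⟩
    · show (fst X' X').left ((lift (𝟙 X') (𝟙 X')).left x) ∈ R c
      rw [← Scheme.Hom.comp_apply, ← Over.comp_left, lift_fst]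
      exact ⟨y, hy⟩
    · show (snd X' X').left ((lift (𝟙 X') (𝟙 X')).left x) ∈ R c
      rw [← Scheme.Hom.comp_apply, ← Over.comp_left, lift_snd]
      exact ⟨y, hy⟩
  have hmin : ∀ (W : SchemeOver L) (j : W ⟶ X' ⊗ X'), IsOpenImmersion j.left → IsClosedImmersion j.left →
      (∃ δ : X' ⟶ W, δ ≫ j = lift (𝟙 X') (𝟙 X')) → U ⊆ Set.range ⇑j.left := by
    rintro W j hjo hjc ⟨δ, hδ⟩ z hz
    haveI := hjo
    haveI := hjc
    obtain ⟨c, hc⟩ := Set.mem_iUnion.mp hz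
    have hz' : z ∈ Set.range (inj c ⊗ₘ inj c).left := by rw [range_tensorHom_left_eq]; exact hc
    exact range_tensorHom_subset_range_of_diag j hδ c hz'
  obtain ⟨N, -⟩ := Nabla.exists_of_isClopen X' U ⟨hUc, hUo⟩ hΔ hmin
  exact ⟨N⟩

/-- The first coordinate of a `T`-point of `∇X'` over `(p, q)` at a point `w` of `T` is `p(w)`. Ours.
[cite: Liu2021, §2.1 Def. 2.1 (1) (l. 1171–1174)] -/
private theorem fst_incl_apply' (N : Nabla X') {T : SchemeOver L} (p q : T ⟶ X') (pq : T ⟶ N.N)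
    (hpq : pq ≫ N.incl = lift p q) (w : T.left) : (fst X' X').left (N.incl.left (pq.left w)) = p.left w := by
  have : (fst X' X').left (N.incl.left (pq.left w)) = ((pq ≫ N.incl) ≫ fst X' X').left w := by
    simp only [Over.comp_left, Scheme.Hom.comp_apply]
  rw [this, hpq, lift_fst]

/-- The second coordinate of a `T`-point of `∇X'` over `(p, q)` at a point `w` of `T` is `q(w)`. Ours.
[cite: Liu2021, §2.1 Def. 2.1 (1) (l. 1171–1174)] -/
private theorem snd_incl_apply' (N : Nabla X') {T : SchemeOver L} (p q : T ⟶ X') (pq : T ⟶ N.N)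
    (hpq : pq ≫ N.incl = lift p q) (w : T.left) : (snd X' X').left (N.incl.left (pq.left w)) = q.left w := by
  have : (snd X' X').left (N.incl.left (pq.left w)) = ((pq ≫ N.incl) ≫ snd X' X').left w := by
    simp only [Over.comp_left, Scheme.Hom.comp_apply]
  rw [this, hpq, lift_snd]

/-- If `(p, q)` is a `T`-point of `∇X'` and `p(w) ∈ Y_c`, then `q(w) ∈ Y_c`. Ours.
[cite: Liu2021, §2.1 proof of the Proposition (l. 1194–1200)] -/
private theorem mem_range_snd_of_mem_range_fst' [Finite κ] (N : Nabla X') (hcol : IsColimit (Cofan.mk X' inj))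
    (c : κ) {T : SchemeOver L} (p q : T ⟶ X') (pq : T ⟶ N.N) (hpq : pq ≫ N.incl = lift p q) (w : T.left)
    (hw : p.left w ∈ Set.range (inj c).left) : q.left w ∈ Set.range (inj c).left := by
  rw [← snd_incl_apply' N p q pq hpq w]
  exact N.snd_mem_range_of_fst_mem_range hcol c (pq.left w) (by rwa [fst_incl_apply' N p q pq hpq w])

omit [Small.{u} κ] in
/-- A morphism to `X × X` with image inside `∇X` lifts to a `T`-point of `∇X` (the inclusion is an open immersion). Ours.
[cite: Liu2021, §2.1 Def. 2.1 (1) (l. 1171–1174)] -/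
theorem Nabla.exists_point_of_range_subset {K : Type u} [Field K] {X : SchemeOver K} (N : Nabla X)
    {T : SchemeOver K} (f : T ⟶ X ⊗ X) (hf : Set.range f.left ⊆ Set.range N.incl.left) :
    ∃ ac : T ⟶ N.N, ac ≫ N.incl = f := by
  haveI := N.isOpenImmersion_incl
  let l₀ := IsOpenImmersion.lift N.incl.left f.left hf
  have hl₀ : l₀ ≫ N.incl.left = f.left := IsOpenImmersion.lift_fac _ _ _
  refine ⟨Over.homMk l₀ ?_, Over.OverMorphism.ext hl₀⟩
  rw [← Over.w N.incl, ← Category.assoc, hl₀]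
  exact Over.w f

/-- **`∇` of a split scheme is transitive.**  For a colimit cofan `inj_c : Y_c ⟶ X'` (`κ` finite) of geometrically
irreducible `L`-schemes and ANY `∇X'`, `T`-points over `(a,b)` and `(b,c)` yield one over `(a,c)`: pointwise `a(w)`, `b(w)`,
`c(w)` lie in one piece `Y_{c₀}`, so `(a,c)(w) ∈ Y_{c₀} × Y_{c₀} ⊆ ∇X'` (`range_tensorHom_subset_range_incl`), and `(a,c)`
lifts through the open immersion `∇X' ↪ X' × X'`.  Ours. [cite: Liu2021, §2.1 Def. 2.1 (1) (l. 1171–1174) and proof of the Proposition (l. 1194–1200)] -/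
theorem Nabla.isTransitive_of_isColimit [Finite κ] (N : Nabla X') (hcol : IsColimit (Cofan.mk X' inj))
    (hirr : ∀ c, GeometricallyIrreducible (Y c).hom) : N.IsTransitive := by
  haveI := hirr
  intro T a b c ab bc hab hbc
  refine N.exists_point_of_range_subset (lift a c) ?_
  rintro _ ⟨w, rfl⟩
  obtain ⟨c₀, y, hy⟩ := exists_eq_left_of_isColimit hcol (a.left w)
  have ha : a.left w ∈ Set.range (inj c₀).left := ⟨y, hy⟩
  have hb : b.left w ∈ Set.range (inj c₀).left := mem_range_snd_of_mem_range_fst' N hcol c₀ a b ab hab w ha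
  have hc : c.left w ∈ Set.range (inj c₀).left := mem_range_snd_of_mem_range_fst' N hcol c₀ b c bc hbc w hb
  refine range_tensorHom_subset_range_incl (inj := inj) N c₀ ?_
  rw [range_tensorHom_left_eq]
  refine ⟨?_, ?_⟩
  · show (fst X' X').left ((lift a c).left w) ∈ Set.range (inj c₀).left
    rw [← Scheme.Hom.comp_apply, ← Over.comp_left, lift_fst]
    exact ha
  · show (snd X' X').left ((lift a c).left w) ∈ Set.range (inj c₀).left
    rw [← Scheme.Hom.comp_apply, ← Over.comp_left, lift_snd]
    exact hc

end Pieces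

/-! ## Descent along a field extension -/

section Descent

variable {k : Type u} [Field k] (L : Type u) [Field L] [Algebra k L] {X : SchemeOver k}

/-- **Transitivity descends along base change.**  Let `N` be a `∇X` over `k`, `N'` a `∇(X_L)` and
`e : (∇X)_L ≅ ∇(X_L)` an isomorphism over `X_L × X_L` (`e ≫ incl' ≫ μ = incl_L`).  If `∇(X_L)` is transitive, so is `∇X`:
for `T`-points `(a,b), (b,c)` of `∇X`, transitivity over `L` gives a `T_L`-point of `(∇X)_L` over `(a,c)_L`, and since
`T_L → T` is surjective the image of `(a,c) : T → X × X` lies in `∇X`, through whose open inclusion it lifts.  Ours.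
[cite: Liu2021, §2.1 proof of the Proposition (l. 1194–1200)] [cite: GortzWedhorn2020, §(14.20), Def. 14.84] -/
theorem Nabla.IsTransitive.of_baseChange (N : Nabla X) (N' : Nabla ((bcFunctor k L).obj X))
    (e : (bcFunctor k L).obj N.N ≅ N'.N)
    (he : e.hom ≫ N'.incl ≫ Functor.LaxMonoidal.μ (bcFunctor k L) X X = (bcFunctor k L).map N.incl)
    (h : N'.IsTransitive) : N.IsTransitive := by
  intro T a b c ab bc hab hbc
  have he' : e.hom ≫ N'.incl = (bcFunctor k L).map N.incl ≫ Functor.OplaxMonoidal.δ (bcFunctor k L) X X := by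
    rw [← he, Category.assoc, Category.assoc, Functor.Monoidal.μ_δ, Category.comp_id]
  have hpt : ∀ (u v : T ⟶ X) (uv : T ⟶ N.N), uv ≫ N.incl = lift u v →
      ((bcFunctor k L).map uv ≫ e.hom) ≫ N'.incl = lift ((bcFunctor k L).map u) ((bcFunctor k L).map v) := by
    intro u v uv huv
    rw [Category.assoc, he', ← Functor.map_comp_assoc, huv, ← Functor.Monoidal.lift_μ, Category.assoc,
      Functor.Monoidal.μ_δ, Category.comp_id]
  obtain ⟨AC', hAC'⟩ := h _ _ _ _ _ (hpt a b ab hab) (hpt b c bc hbc)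
  -- `AC := AC' ≫ e⁻¹ : T_L → (∇X)_L` lies over `(a,c)_L`
  have hAC : (AC' ≫ e.inv) ≫ (bcFunctor k L).map N.incl = (bcFunctor k L).map (lift a c) := by
    rw [Category.assoc, ← he, e.inv_hom_id_assoc, ← Category.assoc, hAC', Functor.Monoidal.lift_μ]
  refine N.exists_point_of_range_subset (lift a c) ?_
  rintro _ ⟨w, rfl⟩
  obtain ⟨w', hw'⟩ := (pullback.fst T.hom (bcSpec k L)).surjective w
  refine ⟨pullback.fst N.N.hom (bcSpec k L) ((AC' ≫ e.inv).left w'), ?_⟩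
  have E : pullback.fst T.hom (bcSpec k L) ≫ (lift a c).left =
      (AC' ≫ e.inv).left ≫ pullback.fst N.N.hom (bcSpec k L) ≫ N.incl.left := by
    rw [← GaloisDescent.bcFunctor_map_left_comp_fst L (lift a c), ← hAC, Over.comp_left, Category.assoc,
      GaloisDescent.bcFunctor_map_left_comp_fst]
  have E' := congrArg (fun φ => φ w') E
  simp only [Scheme.Hom.comp_apply] at E'
  rw [← hw']
  exact E'.symm

end Descent

/-! ## The theorem -/

/-- **[Liu2021, §2.1 Def. 2.1 (1)] `∇X` is transitive for `X` smooth projective over a field of characteristic zero.**  For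
`k` of characteristic zero, `X` smooth of relative dimension `d` and projective over `k`, and ANY `∇X` (`AppendixC.Nabla X`),
`T`-points over `(a,b)` and `(b,c)` give one over `(a,c)` (`Nabla.IsTransitive`); with `Nabla.exists_swap` and the diagonal,
`∇X` is an equivalence relation on `X`.  Proof: finite Galois splitting field (`exists_isGalois_isColimit_isSmoothProjective`),
a `∇(X_L)` (`Nabla.nonempty_of_isColimit`) which is transitive (`Nabla.isTransitive_of_isColimit`), `(∇X)_L ≅ ∇(X_L)` over
`X_L × X_L` for a descended carrier (`Nabla.exists_of_nabla_baseChange_incl`), descent (`IsTransitive.of_baseChange`) and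
transport to the given carrier (`IsTransitive.of_nabla`).  Ours. [cite: Liu2021, §2.1 Def. 2.1 (1) (l. 1171–1174) and proof of the Proposition (l. 1194–1200)] -/
theorem Nabla.isTransitive_of_isProjectiveOver {k : Type u} [Field k] [CharZero k] {d : ℕ} {X : SchemeOver k}
    [SmoothOfRelativeDimension d X.hom] (hX : IsProjectiveOver X) (N : Nabla X) : N.IsTransitive := by
  obtain ⟨L, _, _, _, _, C, _, E, inj, hE, ⟨hcol⟩⟩ :=
    exists_isGalois_isColimit_isSmoothProjective (d := d) X hX
  have hirr : ∀ c, GeometricallyIrreducible (E c).hom := fun c => (hE c).geometricallyIrreducible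
  obtain ⟨N'⟩ := Nabla.nonempty_of_isColimit hcol hirr
  obtain ⟨N₀, e, he, -⟩ := Nabla.exists_of_nabla_baseChange_incl L N'
  exact (Nabla.IsTransitive.of_baseChange L N₀ N' e he (N'.isTransitive_of_isColimit hcol hirr)).of_nabla

end Literature.NumberTheory.Automorphic.Liu2021.AppendixC

end
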